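import Summits.Ventures.CertifiedArithmetic.Expansions.DyadicValuation
import Summits.Ventures.CertifiedArithmetic.Expansions.CompressFixedPointIff
import Mathlib.Tactic.Linarith

/-!
# Nonadjacent expansions of full-odd floats are fixed points of COMPRESS

New work of the certified-arithmetic venture (ENGINES group: shared numerical engines serving
client cells; rigour lives in the verifiers; every published number belongs to a client cell's
ledger, not to the engines group).

A SUFFICIENT CONDITION FOR A FIXED POINT, read off the significands.  Call a float `x` FULL-ODD
when it is no multiple of `2·ulp(x)` (its significand uses all `p` digits and the last one is odd;
`¬ OnGrid (k + 1) x` where `ulp(x) = 2^k`, the absorption hypothesis of `DyadicValuation`).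
`compress_eq_self_of_fullOdd`: under ANY round-to-nearest with `p ≥ 2`, a nonadjacent expansion
(`IsExpansion 2`) of nonzero floats all of whose components EXCEPT POSSIBLY THE SMALLEST are
full-odd is left unchanged by COMPRESS [Shewchuk1997, §2.7].  Mechanism: a component `a`
nonadjacent below a full-odd `b` satisfies `|a| < ulp(b)/2` (`abs_lt_half_ulp_of_below_two`), so
`b` absorbs it, `fl(b + a) = b` (`fl_eq_of_fullOdd` of `DyadicValuation`); hence the expansion is
a chain in the sense of `CompressFixedPointIff.compress_eq_self_iff_isChain`.

HONEST FRAMING.  The condition is sufficient, not necessary: with `p = 3` the expansion `⟨1, 8⟩`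
is a fixed point although `8 = 100₂·2¹` has two trailing zeros (fixed points are exactly the
chains, row `CompressFixedPointIff`).  In the group's desk model of iterated COMPRESS this is the
base case "no trailing zeros above the smallest component ⇒ no further change"; the stronger desk
heuristic "remaining passes ≤ (number of components with trailing zeros) + 1" was REFUTED by the
group's own exhaustive search (`p = 3`, seven components), and nothing of it is claimed here.
Theorem 23 of the paper asserts neither idempotence nor any pass count.
-/

namespace Summit.Ventures.CertifiedArithmetic.Expansions

open Literature.ComputerArithmetic.JeannerodRump2018
open Literature.ComputerArithmetic.BoldoJeannerodMelquiondMuller2023 hiding twoSum twoSum_fst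
open Literature.ComputerArithmetic.Shewchuk1997

variable {p : ℕ} {emin : ℤ} {fl : ℚ → ℚ}

/-- A number on the grid `2^s` that is NOT on the grid `2^(k+1)` has `s ≤ k`.
[cite: Shewchuk1997, §2.1 p. 309 (footnote 2)] -/
theorem le_of_onGrid_of_not_onGrid {s k : ℤ} {x : ℚ} (hs : OnGrid s x)
    (hk : ¬ OnGrid (k + 1) x) : s ≤ k := by
  by_contra h
  exact hk (hs.mono (by omega))

/-- A number NONADJACENT below a full-odd float `b` (`ulp(b) = 2^k`, `b ∉ 2^(k+1)ℤ`) is smaller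
than half an ulp of `b`. [cite: Shewchuk1997, §2.4 p. 319 (nonadjacent)] -/
theorem abs_lt_half_ulp_of_below_two {a b : ℚ} {k : ℤ} (hab : Below 2 a b)
    (hodd : ¬ OnGrid (k + 1) b) : |a| < (2 : ℚ) ^ k / 2 := by
  obtain ⟨s, hsb, hlt⟩ := hab
  have hs : s ≤ k := le_of_onGrid_of_not_onGrid hsb hodd
  have h2 : (2 : ℚ) ^ s ≤ (2 : ℚ) ^ k := zpow_le_zpow_right₀ (by norm_num) hs
  linarith

/-- ABSORPTION LINK: a nonzero float `a` nonadjacent below a full-odd float `b` forms a link of a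
chain — `fl(b + a) = b`, `fl a = a`, `a ≠ 0` — under any round-to-nearest with `p ≥ 2`.
[cite: Shewchuk1997, Thm 23 p. 331–333; BoldoEtAl2023, §2.1 (RN, ulp)] -/
theorem chainLink_of_fullOdd (hp : 2 ≤ p) (hfl : IsRoundNearest p emin fl)
    {a b : ℚ}
    (ha : IsFloat p emin a) (ha0 : a ≠ 0) (hb : IsFloat p emin b) (hab : Below 2 a b)
    (hodd : ∀ k : ℤ, ulp p emin b = (2 : ℚ) ^ k → ¬ OnGrid (k + 1) b) :
    fl (b + a) = b ∧ fl a = a ∧ a ≠ 0 := by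
  obtain ⟨k, -, hk⟩ := exists_ulp_eq_two_zpow (p := p) (emin := emin) b
  refine ⟨fl_eq_of_fullOdd hp hfl hb hk (hodd k hk) ?_, fl_eq_self hfl ha, ha0⟩
  simpa using abs_lt_half_ulp_of_below_two hab (hodd k hk)

/-- A nonadjacent expansion of nonzero floats whose components above the smallest are full-odd is
a CHAIN (each component absorbed by the next). [cite: Shewchuk1997, Thm 23 p. 331–333] -/
theorem isChain_of_fullOdd (hp : 2 ≤ p) (hfl : IsRoundNearest p emin fl) :
    ∀ {e : List ℚ}, (∀ x ∈ e, IsFloat p emin x) → (∀ x ∈ e, x ≠ 0) →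
      IsExpansion 2 e →
      (∀ x ∈ e.tail, ∀ k : ℤ, ulp p emin x = (2 : ℚ) ^ k → ¬ OnGrid (k + 1) x) →
      List.IsChain (fun a b => fl (b + a) = b ∧ fl a = a ∧ a ≠ 0) e
  | [], _, _, _, _ => List.isChain_nil
  | [a], _, _, _, _ => List.isChain_singleton a
  | a :: b :: rest, he, hne, hexp, hodd => by
    have hcons := isExpansion_cons.mp hexp
    refine List.isChain_cons_cons.mpr ⟨?_, ?_⟩
    · exact chainLink_of_fullOdd hp hfl (he a (by simp)) (hne a (by simp))
        (he b (by simp)) (hcons.1 b (by simp)) (hodd b (by simp))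
    · exact isChain_of_fullOdd hp hfl (fun x hx => he x (List.mem_cons_of_mem a hx))
        (fun x hx => hne x (List.mem_cons_of_mem a hx)) hcons.2
        (fun x hx => hodd x (by
          simp only [List.tail_cons] at hx ⊢; exact List.mem_cons_of_mem b hx))

/-- **Full-odd expansions are fixed points of COMPRESS.**  Under any round-to-nearest with
`p ≥ 2`, a nonadjacent expansion of nonzero floats all of whose components except possibly the
smallest are full-odd satisfies `COMPRESS(e) = e`.
[cite: Shewchuk1997, §2.7 Thm 23 p. 331–333] -/
theorem compress_eq_self_of_fullOdd (hp : 2 ≤ p) (hfl : IsRoundNearest p emin fl)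
    {e : List ℚ} (he : ∀ x ∈ e, IsFloat p emin x) (hne : ∀ x ∈ e, x ≠ 0)
    (hexp : IsExpansion 2 e)
    (hodd : ∀ x ∈ e.tail, ∀ k : ℤ, ulp p emin x = (2 : ℚ) ^ k → ¬ OnGrid (k + 1) x) :
    compress fl e = e :=
  (compress_eq_self_iff_isChain hp hfl he (hexp.anti (by norm_num))).mpr
    (isChain_of_fullOdd hp hfl he hne hexp hodd)

/-- The same for IEEE round-to-nearest-even. [cite: Shewchuk1997, §2.7 Thm 23 p. 331–333] -/
theorem compress_eq_self_of_fullOdd_roundTiesEven (hp : 2 ≤ p) {e : List ℚ}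
    (he : ∀ x ∈ e, IsFloat p emin x) (hne : ∀ x ∈ e, x ≠ 0) (hexp : IsExpansion 2 e)
    (hodd : ∀ x ∈ e.tail, ∀ k : ℤ, ulp p emin x = (2 : ℚ) ^ k → ¬ OnGrid (k + 1) x) :
    compress (roundTiesEven p emin) e = e :=
  compress_eq_self_of_fullOdd hp (isRoundNearest_roundTiesEven (by omega)) he hne hexp hodd

/-- ITERATION READING: such an expansion is fixed by every number of passes.
[cite: Shewchuk1997, §2.7 Thm 23 p. 331–333] -/
theorem compress_iterate_eq_self_of_fullOdd (hp : 2 ≤ p) (hfl : IsRoundNearest p emin fl)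
    {e : List ℚ} (he : ∀ x ∈ e, IsFloat p emin x) (hne : ∀ x ∈ e, x ≠ 0)
    (hexp : IsExpansion 2 e)
    (hodd : ∀ x ∈ e.tail, ∀ k : ℤ, ulp p emin x = (2 : ℚ) ^ k → ¬ OnGrid (k + 1) x)
    (n : ℕ) : (compress fl)^[n] e = e :=
  Function.iterate_fixed (compress_eq_self_of_fullOdd hp hfl he hne hexp hodd) n

end Summit.Ventures.CertifiedArithmetic.Expansions
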